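import Summits.HodgeConjecture.HodgeCM.PerL34.FockPrintGenuineKappa_1

/-! PORT of `HodgeCM/PerL34/FockPrintGenuineKappa.lean` (HodgeCMPerL run 82) — part 2: continuation of `Summits.HodgeConjecture.HodgeCM.PerL34.FockPrintGenuineKappa_1` (split at a top-level declaration boundary by port_pkg.py; scope re-opened below; declarations unchanged). -/

-- port_pkg: scope re-opened for this part (file-level context, then the namespace/section stack open at the cut)
set_option autoImplicit false
open MvPolynomial Complex
open scoped Matrix ComplexConjugate Kronecker
namespace HodgeCM.PerL34.Fock.PrintDict
section Plane
/-- **PerL's `κ`-condition at `ι₁` (l. 506–509) ⟺ genuine `K_V`-equivariance in `L²(ℂ⁶)` (KERNEL).**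
A polynomial `f` is a `κ`-vector in the sense of `ArchB.IsKappaVector` (printed weight `(2,2;−1)`, killed by `E_±`)
IF AND ONLY IF its honest Fock vector `f·e^{−(π/2)|z|²} ∈ 𝓕 ⊂ L²(ℂ⁶)` transforms under Folland's `ν₀` restricted to
the genuine compact group `K_V = U(2)_V × U(1)_V ⊂ U(6)` (`KV`, `KL`) by the character `det_{V⁺} ⊗ 1`.  (`⇒`: `f` is a
multiple of `det z` (`ArchB.isKappaVector_iff`) and §3; `⇐`: differentiate along the row tori (RUN 29's
`hasDerivAt_fockRep_torusU_exp_zero`), along `KL`, and along the rotations `R`, `S` of §4 (pv05-g7's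
`hasDerivAt_fockRep_path_one` through `hasDerivAt_fockRep_KV`), then `Hermite.fockToL2_injective` (pv05-g6).) -/
theorem isKappaVector_iff_fockRep (f : PlaneModel) :
    IsKappaVector f ↔
      (∀ h : Matrix.unitaryGroup (Fin 2) ℂ,
          Hermite.fockRep (KV h) (Hermite.fockToL2 f) = (h : Matrix (Fin 2) (Fin 2) ℂ).det • Hermite.fockToL2 f) ∧
      ∀ u : Circle, Hermite.fockRep (KL u) (Hermite.fockToL2 f) = Hermite.fockToL2 f := by
  constructor
  · intro hf
    obtain ⟨c, rfl⟩ := (isKappaVector_iff f).mp hf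
    refine ⟨fun h => ?_, fun u => ?_⟩
    · rw [map_smul, LinearIsometryEquiv.map_smul, fockRep_KV_detZ, smul_comm]
    · rw [map_smul, LinearIsometryEquiv.map_smul, fockRep_KL_detZ]
  · rintro ⟨hV, hL⟩
    have hinj := Hermite.fockToL2_injective (σ := PlaneVar)
    -- (a) the row weights, along the row tori
    have hrow : ∀ a : Fin 2, weightOp (rowWt a) f = f := by
      intro a
      have h1 := hasDerivAt_fockRep_torusU_exp_zero (rowWt a) f
      have h2 : HasDerivAt (fun θ : ℝ => ((Circle.exp θ : Circle) : ℂ) • Hermite.fockToL2 f)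
          (I • Hermite.fockToL2 f) 0 := hasDerivAt_coe_circleExp_zero.smul_const _
      have hfun : (fun θ : ℝ => Hermite.fockRep (torusU (rowWt a) (Circle.exp θ)) (Hermite.fockToL2 f))
          = fun θ : ℝ => ((Circle.exp θ : Circle) : ℂ) • Hermite.fockToL2 f := by
        funext θ
        rw [← KV_phaseU_rowPhase, hV, det_phaseU_rowPhase]
      rw [hfun] at h1
      exact hinj (smul_right_injective (Hermite.FockL2 PlaneVar) I_ne_zero (h1.unique h2))
    -- (b) the `w`-weight, along `KL`
    have hw : weightOp wWt f = 0 := by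
      have h1 := hasDerivAt_fockRep_KL f
      have hfun : (fun θ : ℝ => Hermite.fockRep (KL (Circle.exp θ)) (Hermite.fockToL2 f)) = fun _ => Hermite.fockToL2 f := by
        funext θ; exact hL _
      rw [hfun] at h1
      have h0 := h1.unique (hasDerivAt_const (0 : ℝ) (Hermite.fockToL2 f))
      rw [smul_eq_zero, or_iff_right I_ne_zero, ← map_zero Hermite.fockToL2] at h0
      have := hinj h0
      rwa [dGamma_genV_wline, LinearMap.neg_apply, neg_eq_zero] at this
    -- (c) the root operators, along the rotations `R`, `S`
    have hR : Eplus f - Eminus f = 0 := by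
      have h1 := hasDerivAt_fockRep_KV (g := pathR) (β := velR) (t₀ := 0) (fun i j => hasDerivAt_rotR i j) pathR_zero f
      have hfun : (fun t : ℝ => Hermite.fockRep (KV (pathR t)) (Hermite.fockToL2 f)) = fun _ => Hermite.fockToL2 f := by
        funext t
        rw [hV]
        change (rotR t).det • Hermite.fockToL2 f = _
        rw [det_rotR, one_smul]
      rw [hfun] at h1
      have h0 := h1.unique (hasDerivAt_const (0 : ℝ) (Hermite.fockToL2 f))
      rw [← map_zero Hermite.fockToL2] at h0
      have := hinj h0
      rwa [dGamma_genV_velR] at this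
    have hS : Eplus f + Eminus f = 0 := by
      have h1 := hasDerivAt_fockRep_KV (g := pathS) (β := velS) (t₀ := 0) (fun i j => hasDerivAt_rotS i j) pathS_zero f
      have hfun : (fun t : ℝ => Hermite.fockRep (KV (pathS t)) (Hermite.fockToL2 f)) = fun _ => Hermite.fockToL2 f := by
        funext t
        rw [hV]
        change (rotS t).det • Hermite.fockToL2 f = _
        rw [det_rotS, one_smul]
      rw [hfun] at h1
      have h0 := h1.unique (hasDerivAt_const (0 : ℝ) (Hermite.fockToL2 f))
      rw [← map_zero Hermite.fockToL2] at h0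
      have := hinj h0
      rw [dGamma_genV_velS, smul_eq_zero, or_iff_right I_ne_zero] at this
      exact this
    have hplus : Eplus f = 0 := by
      have h2 : (2 : ℂ) • Eplus f = 0 := by
        rw [two_smul]
        have := congrArg₂ (· + ·) hR hS
        simp only [add_zero] at this
        rw [← this]; abel
      exact (smul_eq_zero.mp h2).resolve_left two_ne_zero
    have hminus : Eminus f = 0 := by
      rw [hplus, zero_add] at hS; exact hS
    exact ⟨hrow 0, hrow 1, hw, hplus, hminus⟩

/-- **Corollary — PerL's `φ⁰_{ι₁}` (l. 510) GENUINELY.**  With `ArchB.isKappaVector_iff`: a polynomial Fock vector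
`f·e^{−(π/2)|z|²} ∈ 𝓕 ⊂ L²(ℂ⁶)` is `(det_{V⁺} ⊗ 1)`-equivariant under the genuine `K_V = U(2)_V × U(1)_V` iff `f` lies
on the line `ℂ · det z`. -/
theorem fockRep_KV_KL_iff_smul_detZ (f : PlaneModel) :
    ((∀ h : Matrix.unitaryGroup (Fin 2) ℂ,
          Hermite.fockRep (KV h) (Hermite.fockToL2 f) = (h : Matrix (Fin 2) (Fin 2) ℂ).det • Hermite.fockToL2 f) ∧
      ∀ u : Circle, Hermite.fockRep (KL u) (Hermite.fockToL2 f) = Hermite.fockToL2 f)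
      ↔ ∃ c : ℂ, f = c • detZ := by
  rw [← isKappaVector_iff_fockRep, isKappaVector_iff]

end Plane

end HodgeCM.PerL34.Fock.PrintDict
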